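import Summits.BirchSwinnertonDyer.BirchSwinnertonDyer.Theorems.TeichmullerTwistDescentKOfNamedInputs
import HarnessLib

/-!
# Route `TeichmullerTwistDescent`: the support item `TwistedPeriodLatticeSaturationOfNamedInputs`
# (stmt-BirchSwinnertonDyer-31170) — closed BY NAME

Cell `pub/bsd-wall` (D-0145 line route-BirchSwinnertonDyer-TeichmullerTwistDescent, OPEN rev 8), seat `bsd-line-ttd-p1`
(prover 1/2, g29).

The route planner filed (rev 8) the K-line closure record asked for by g28: the crux K
`TwistedPeriodLatticeSaturation` (stmt-BirchSwinnertonDyer-25368) FROM ITS FIVE NAMED PUBLISHED INPUTS — modularity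
`exists_isNewformOf` (C13), the Conrad–Diamond–Taylor tame principal-series type of the full-level homology
`fullLevelHomology_isIsotypic_tamePrincipalSeries_of_central` (centre-pinned), the SIGNED Buzzard–Diamond–Jarvis /
Ash–Stevens weight statement `fullLevelHomology_twist_isModular_of_eigenMap_signed`, Kraus 1997 Prop. 1
`Kraus1997.propOne_inertiaShape_of_ordinary`, and Edixhoven 1992 Thm. 4.5
`edixhoven1992_serreWeight_le_weight_of_newform`.  This file proves that decl VERBATIM, by the landed theorem
`KOfNamedInputs.twistedPeriodLatticeSaturation_of_named_inputs` (`Theorems/TeichmullerTwistDescentKOfNamedInputs.lean`).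

HONESTY.  This closes the SUPPORT item 31170 only.  The crux K (25368) is NOT closed by it: K remains CONDITIONAL on the
five named inputs (four cite-only published statements + modularity).  BSD is not proved by this file.
-/

set_option autoImplicit false
-- single-conjunct summit: `Summit.BirchSwinnertonDyer.BirchSwinnertonDyer.…` repeats the name by design
set_option linter.dupNamespace false

namespace Summit.BirchSwinnertonDyer.BirchSwinnertonDyer.Theorems.TeichmullerTwistDescent

/-- **Item stmt-BirchSwinnertonDyer-31170, by name.**  The route decl `TwistedPeriodLatticeSaturationOfNamedInputs`
(modularity → CDT tame type (centre-pinned) → signed BDJ/AS weight statement → Kraus 1997 Prop. 1 → Edixhoven 1992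
Thm. 4.5 → K) holds: it is exactly `KOfNamedInputs.twistedPeriodLatticeSaturation_of_named_inputs`.  K itself stays
conditional on those five named inputs; BSD is not proved by this. -/
theorem twistedPeriodLatticeSaturationOfNamedInputs_proof :
    Summit.BirchSwinnertonDyer.BirchSwinnertonDyer.Theses.TeichmullerTwistDescent.TwistedPeriodLatticeSaturationOfNamedInputs := by
  unfold Summit.BirchSwinnertonDyer.BirchSwinnertonDyer.Theses.TeichmullerTwistDescent.TwistedPeriodLatticeSaturationOfNamedInputs
  intro hnf hT hWt hKr hEd
  exact KOfNamedInputs.twistedPeriodLatticeSaturation_of_named_inputs hnf hT hWt hKr hEd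

end Summit.BirchSwinnertonDyer.BirchSwinnertonDyer.Theorems.TeichmullerTwistDescent
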